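import Summits.BirchSwinnertonDyer.Rank1Residual.P2.CongruentNumberThetaStarTowersBSD
import Summits.BirchSwinnertonDyer.Rank1Residual.P2.CongruentNumberThetaStarSilent
import Mathlib.NumberTheory.LSeries.PrimesInAP
import HarnessLib
import HarnessLib.Audit.Tags

/-!
# Cell «bsd-monsky» (prover-B): 𝒮⁻-TOWERS EXIST ABOVE EVERY BOUND, OF EVERY HEIGHT — for every `k ≥ 2` and every `B` there is a
# square-free `n ≡ 6 (mod 8)` with exactly `k` odd prime factors, all but `3, 5` larger than `B`, on which Tian–Yuan–Zhang's Thm. 1.2 is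
# SILENT and `ord_{s=1} L(E_n, s) = 1`, rank `1`, `Ш[2^∞] = 0`, `BSD(E_n, 2)` hold (Dirichlet + the tower theorems; nothing asserted, nothing booked)

HONEST FRAMING (cell `bsd-monsky`, run/shared/lean/pub/bsd-monsky/; README §1/§3): «ℓ ≥ 3 rungs are NOT claimed — record what the same
argument gives there, no more». `…ThetaStarTowersBSD` proves Monsky's (a)+(b) shape on every 𝒮⁻-tower `2·q·p·p₁⋯p_m` and `…ThetaStarSilent`
proves that TYZ's Thm. 1.2 is silent there. THIS FILE adds the existence of towers of every height over the smallest pair `(p, q) = (5, 3) ∈ 𝒮⁻`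
(`n = 30` = book230 class `30`): by Dirichlet's theorem on primes in arithmetic progressions (Mathlib, `Nat.forall_exists_prime_gt_and_eq_mod`)
and the Chinese remainder theorem there are, above any bound, primes `p₁, …, p_m` with `pᵢ ≡ 5 (mod 8)` and `pᵢ ≡ 1 (mod 3)`, `(mod 5)`,
`(mod pⱼ)` (`j < i`) — so `(pᵢ/3) = (pᵢ/5) = (pᵢ/pⱼ) = +1` (§1, `exists_tower_primes`). Hence (§2, `forall_exists_silent_sminus_tower`), relative
to {`tyz_cmPointGaloisData`, `thm11_parity_of_scriptL`, GZK, `monsky_card_selmerGroup_two_even`}: for every `m` and `B` there is an injective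
`p : Fin m → primes ≡ 5 (mod 8)` above `B` with `n = 2·3·5·p₁⋯p_m` TYZ-SILENT (`Σ₂′(n)` even — modulo Rédei–Reichardt only) and
`ord_{s=1} L(E_n, s) = 1`, rank `1`, `Ш(E_n)[2^∞] = 0`, `BSD(E_n, 2)`. This is route B's analogue, at the prime `2` and on the SILENT side, of
Tian's Theorem 1.1 («for every `k` infinitely many congruent `n ≡ 6 (mod 8)` with exactly `k + 1` odd prime factors», proved there for
towers of primes `≡ 1 (mod 8)` on which TYZ's criterion speaks). CONDITIONAL on the named facts said; nothing asserted; no count moves; no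
class booked. NOT refereed; not part of PROOF-B v1.3 or of the paper.

References: [Tian2014] Thm. 1.1, Thm. 5.2 (arXiv p. 28 L40–L55: Dirichlet + residue conditions); [TianYuanZhang2017] Thm. 1.2;
[Monsky1990MockHeegner] p. 67 Remark (3); [IrelandRosen1990] Ch. 5 §2 Thm. 2; [HardyWright2008] §2.1 (Dirichlet), §8.1 (CRT);
HOME/proof/PROOF-B-THETA-STAR.md §7–§9.
-/

noncomputable section

open scoped Classical

open Matrix Finset WeierstrassCurve Literature.NumberTheory.EllipticCurves
  Literature.NumberTheory.EllipticCurves.Rank1Residual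
  Literature.NumberTheory.EllipticCurves.Rank1Residual.Typed
  Literature.NumberTheory.EllipticCurves.HeathBrown1994
  Literature.NumberTheory.EllipticCurves.TianYuanZhang2017
  Literature.NumberTheory.EllipticCurves.TianYuanZhang2017.W2
  Literature.NumberTheory.QuadraticFields.RedeiReichardt

set_option autoImplicit false

namespace Summit.BirchSwinnertonDyer.Rank1Residual.P2

namespace ThetaDescent

/-! ## §1 Primes `≡ 5 (mod 8)` that are residues of `3`, `5` and of each other, above any bound (Dirichlet + CRT) -/

/-- A prime `P ≡ 1 (mod b)` is a quadratic residue of the odd prime `b`: `(P/b) = (1/b) = 1`. [cite: IrelandRosen1990, Ch. 5 §1 Prop. 5.1.2] -/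
theorem jacobiSym_eq_one_of_mod_eq_one {P b : ℕ} (h : P % b = 1) : jacobiSym P b = 1 := by
  rw [jacobiSym.mod_left, ← Int.natCast_mod, h, Nat.cast_one, jacobiSym.one_left]

/-- **Towers of every height above every bound.** For every `m` and `B` there are primes `B < p₁, …, p_m ≡ 5 (mod 8)`, pairwise distinct,
with `(pᵢ/3) = (pᵢ/5) = +1` and `(pⱼ/pᵢ) = +1` for all `i ≠ j` (Dirichlet's theorem for the modulus `8·15·p₁⋯p_{m−1}` and the residue
`≡ 5 (mod 8)`, `≡ 1 (mod 15·p₁⋯p_{m−1})`, by induction on `m`). [cite: Tian2014, proof of Thm. 5.2 (arXiv p. 28 L44–L55)] [cite: HardyWright2008, §2.1, §8.1] -/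
theorem exists_tower_primes (m B : ℕ) :
    ∃ p : Fin m → ℕ, (∀ i, (p i).Prime) ∧ (∀ i, p i % 8 = 5) ∧ (∀ i, B < p i) ∧ Function.Injective p ∧
      (∀ i, jacobiSym (p i) 3 = 1) ∧ (∀ i, jacobiSym (p i) 5 = 1) ∧ (∀ i j, i ≠ j → jacobiSym (p j) (p i) = 1) := by
  induction m with
  | zero => exact ⟨Fin.elim0, fun i => i.elim0, fun i => i.elim0, fun i => i.elim0, fun i => i.elim0, fun i => i.elim0,
      fun i => i.elim0, fun i => i.elim0⟩
  | succ m ih =>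
    obtain ⟨p, hp, hp5, hpB, hinj, h3, h5, hQR⟩ := ih
    -- the modulus `N = 15·∏pᵢ` (odd) and the residue `k ≡ 5 (mod 8)`, `k ≡ 1 (mod N)`
    set N : ℕ := 15 * ∏ i, p i with hN
    have hNodd : N % 2 = 1 := by
      have hPodd : (∏ i, p i) % 2 = 1 := by
        rcases mod_eight_of_dvd_prod_five hp hp5 hinj (dvd_refl _) with h | h <;> omega
      rw [hN, Nat.mul_mod, hPodd]
    have hNpos : 0 < N := by rw [hN]; exact Nat.mul_pos (by norm_num) (Finset.prod_pos fun i _ => (hp i).pos)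
    have hco : Nat.Coprime 8 N := by
      rw [show (8 : ℕ) = 2 ^ 3 by norm_num]
      exact Nat.Coprime.pow_left 3 (Nat.coprime_two_left.mpr (Nat.odd_iff.mpr hNodd))
    obtain ⟨k, hk8, hkN⟩ := Nat.chineseRemainder hco 5 1
    have hkunit : IsUnit ((k : ZMod (8 * N))) := by
      rw [ZMod.isUnit_iff_coprime]
      refine Nat.Coprime.mul_right ?_ ?_
      · have : k % 8 = 5 := hk8
        rw [show (8 : ℕ) = 2 ^ 3 by norm_num]
        exact Nat.Coprime.pow_right 3 (Nat.coprime_two_right.mpr (Nat.odd_iff.mpr (by omega)))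
      · rw [Nat.coprime_iff_gcd_eq_one, Nat.ModEq.gcd_eq hkN, Nat.gcd_one_left]
    haveI : NeZero (8 * N) := ⟨Nat.mul_ne_zero (by norm_num) hNpos.ne'⟩
    obtain ⟨P, hPgt, hPp, hPk⟩ := Nat.forall_exists_prime_gt_and_eq_mod hkunit (B + 5 + ∑ i, p i)
    have hPk' : P ≡ k [MOD 8 * N] := (ZMod.natCast_eq_natCast_iff _ _ _).mp hPk
    have hP8 : P % 8 = 5 := (hPk'.of_mul_right N).trans hk8
    have hPN : P ≡ 1 [MOD N] := (hPk'.of_mul_left 8).trans hkN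
    have hPmod : ∀ d, d ∣ N → 1 < d → P % d = 1 := fun d hd hd1 => by
      have h := (hPN.of_dvd hd : P ≡ 1 [MOD d])
      rw [Nat.ModEq, Nat.mod_eq_of_lt hd1] at h
      exact h
    have hP3 : P % 3 = 1 := hPmod 3 (by rw [hN]; exact Dvd.intro (5 * ∏ i, p i) (by ring)) (by norm_num)
    have hP5 : P % 5 = 1 := hPmod 5 (by rw [hN]; exact Dvd.intro (3 * ∏ i, p i) (by ring)) (by norm_num)
    have hPi : ∀ i, P % p i = 1 := fun i =>
      hPmod (p i) (by rw [hN]; exact (Finset.dvd_prod_of_mem p (mem_univ i)).trans (dvd_mul_left _ 15)) (hp i).one_lt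
    have hPgt' : ∀ i, p i < P := fun i =>
      lt_of_le_of_lt (Finset.single_le_sum (fun j _ => Nat.zero_le (p j)) (mem_univ i)) (by omega)
    refine ⟨vecCons P p, ?_, ?_, ?_, ?_, ?_, ?_, ?_⟩
    · exact fun i => Fin.cases (by simpa using hPp) (fun j => by simpa using hp j) i
    · exact fun i => Fin.cases (by simpa using hP8) (fun j => by simpa using hp5 j) i
    · exact fun i => Fin.cases (by simp; omega) (fun j => by simpa using hpB j) i
    · have h : Function.Injective (Fin.cons P p : Fin (m + 1) → ℕ) := by
        rw [Fin.cons_injective_iff]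
        exact ⟨by rintro ⟨i, hi⟩; exact (hPgt' i).ne hi, hinj⟩
      exact h
    · exact fun i => Fin.cases (by simpa using jacobiSym_eq_one_of_mod_eq_one hP3) (fun j => by simpa using h3 j) i
    · exact fun i => Fin.cases (by simpa using jacobiSym_eq_one_of_mod_eq_one hP5) (fun j => by simpa using h5 j) i
    · intro i j hij
      induction i using Fin.cases with
      | zero =>
        induction j using Fin.cases with
        | zero => exact absurd rfl hij
        | succ j' =>
          -- `(p_{j'} / P) = (P / p_{j'}) = 1` by reciprocity (`p_{j'} ≡ 1 (mod 4)`)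
          simp only [cons_val_zero, cons_val_succ]
          rw [jacobiSym.quadratic_reciprocity_one_mod_four (by have := hp5 j'; omega) (hPp.odd_of_ne_two (by omega))]
          exact jacobiSym_eq_one_of_mod_eq_one (hPi j')
      | succ i' =>
        induction j using Fin.cases with
        | zero =>
          simp only [cons_val_zero, cons_val_succ]
          exact jacobiSym_eq_one_of_mod_eq_one (hPi i')
        | succ j' =>
          simp only [cons_val_succ]
          exact hQR i' j' fun h => hij (by rw [h])

/-! ## §2 Silent 𝒮⁻-towers of every height with (a)+(b), above every bound -/

/-- **For every `m` and every bound `B`: a TYZ-SILENT `n = 2·3·5·p₁⋯p_m ≡ 6 (mod 8)` with `m + 2` distinct odd prime factors, `B < pᵢ ≡ 5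
(mod 8)`, on which `ord_{s=1} L(E_n, s) = 1`, rank `E_n(ℚ) = 1`, `Ш(E_n)[2^∞] = 0` and `BSD(E_n, 2)` hold** — route B's analogue, at the prime
`2` and where Tian–Yuan–Zhang's criterion is silent, of Tian's «congruent numbers with arbitrarily many prime factors» (the tower over the
pair `(5, 3) ∈ 𝒮⁻`, i.e. over `n = 30`). The silence `Even Σ₂′(n)` is modulo Rédei–Reichardt only; (a)+(b) are relative to
{`tyz_cmPointGaloisData`, `thm11_parity_of_scriptL`, `rank_eq_analyticRank_of_analyticRank_le_one`, `monsky_card_selmerGroup_two_even`}.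
CONDITIONAL; nothing asserted; no class booked; NOT refereed. [cite: Tian2014, Thm. 1.1 (arXiv p. 1 L30–L33), Thm. 5.2]
[cite: TianYuanZhang2017, Thm. 1.2 (p0002 L115–L127)] [cite: Monsky1990MockHeegner, p. 67 Remark (3)] -/
theorem forall_exists_silent_sminus_tower (hCM : tyz_cmPointGaloisData) (hGZK : rank_eq_analyticRank_of_analyticRank_le_one)
    (hMe : monsky_card_selmerGroup_two_even) (h11 : thm11_parity_of_scriptL) (m B : ℕ) :
    ∃ p : Fin m → ℕ, (∀ i, (p i).Prime ∧ p i % 8 = 5 ∧ B < p i) ∧ Function.Injective p ∧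
      Even (genusSum₂' (2 * (3 * (5 * ∏ i, p i))) fun d => genusClassNumber (GenusField d)) ∧
      (congruentNumberCurve (2 * (3 * (5 * ∏ i, p i)))).analyticRank = 1 ∧
      (congruentNumberCurve (2 * (3 * (5 * ∏ i, p i)))).mordellWeilRank = 1 ∧
      AddCommGroup.primaryComponent (congruentNumberCurve (2 * (3 * (5 * ∏ i, p i)))).sha 2 = ⊥ ∧
      BSDp (congruentNumberCurve (2 * (3 * (5 * ∏ i, p i)))) 2 := by
  obtain ⟨p, hp, hp5, hpB, hinj, h3, h5, hQR⟩ := exists_tower_primes m B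
  have h53 : jacobiSym (5 : ℕ) 3 = -1 := by norm_num
  refine ⟨p, fun i => ⟨hp i, hp5 i, hpB i⟩, hinj, ?_,
    rankOne_sha_bsdp_two_sminus_tower hCM hGZK hMe h11 m 5 3 p (by norm_num) (by norm_num) (by norm_num) (by norm_num) h53
      hp hp5 hinj h3 h5 hQR⟩
  -- silence: the one-mark tower hypotheses for `q = 3`, five-primes `(5, p₁, …, p_m)`, mark at `5`
  have hprod : 5 * ∏ i, p i = ∏ i, (vecCons 5 p : Fin (m + 1) → ℕ) i := by rw [Fin.prod_univ_succ]; simp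
  have hne5 : ∀ i, p i ≠ 5 := fun i h => by
    have h1 := h5 i; rw [h, jacobiSym.mod_left] at h1
    simp [jacobiSym.zero_left (by norm_num : 1 < 5)] at h1
  have hPp : ∀ i, ((vecCons 5 p : Fin (m + 1) → ℕ) i).Prime :=
    fun i => Fin.cases (by simpa using Nat.prime_five) (fun j => by simpa using hp j) i
  have hP5 : ∀ i, (vecCons 5 p : Fin (m + 1) → ℕ) i % 8 = 5 :=
    fun i => Fin.cases (by simp) (fun j => by simpa using hp5 j) i
  have hPinj : Function.Injective (vecCons 5 p : Fin (m + 1) → ℕ) := by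
    have h : Function.Injective (Fin.cons 5 p : Fin (m + 1) → ℕ) := by
      rw [Fin.cons_injective_iff]
      exact ⟨by rintro ⟨i, hi⟩; exact hne5 i hi, hinj⟩
    exact h
  -- bits
  have hbit1 : ∀ {x y : ℕ}, x.Prime → y.Prime → y ≠ 2 → x ≠ y → jacobiSym x y = 1 → kroneckerBit x y = 0 :=
    fun hx hy hy2 hxy h => (kroneckerBit_of_jacobiSym hx hy hy2 hxy).1 h
  have hPQR : ∀ i j : Fin (m + 1), i ≠ j →
      kroneckerBit ((vecCons 5 p : Fin (m + 1) → ℕ) j) ((vecCons 5 p : Fin (m + 1) → ℕ) i) = 0 := by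
    intro i j hij
    refine hbit1 (hPp j) (hPp i) (by have := hP5 i; omega) (fun h => hij.symm (hPinj h)) ?_
    induction i using Fin.cases with
    | zero =>
      induction j using Fin.cases with
      | zero => exact absurd rfl hij
      | succ j' => simpa using h5 j'
    | succ i' =>
      induction j using Fin.cases with
      | zero =>
        simp only [cons_val_zero, cons_val_succ]
        rw [jacobiSym.quadratic_reciprocity_one_mod_four (by norm_num) ((hp i').odd_of_ne_two (by have := hp5 i'; omega))]
        exact h5 i'
      | succ j' =>
        simp only [cons_val_succ]
        exact hQR i' j' fun h => hij (by rw [h])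
  have ha : kroneckerBit ((vecCons 5 p : Fin (m + 1) → ℕ) 0) 3 = 1 := by
    simpa using (kroneckerBit_of_jacobiSym Nat.prime_five Nat.prime_three (by norm_num) (by norm_num)).2 h53
  have ha1 : ∀ i : Fin (m + 1), kroneckerBit ((vecCons 5 p : Fin (m + 1) → ℕ) i) 3 = 1 → i = 0 := by
    intro i hi
    induction i using Fin.cases with
    | zero => rfl
    | succ j =>
      exfalso
      have h0 : kroneckerBit ((vecCons 5 p : Fin (m + 1) → ℕ) j.succ) 3 = 0 := by
        simp only [cons_val_succ]
        exact hbit1 (hp j) Nat.prime_three (by norm_num) (fun h => by have := hp5 j; omega) (h3 j)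
      rw [h0] at hi
      exact zero_ne_one hi
  have hsil := even_genusSum₂'_tower (q := 3) Nat.prime_three (by norm_num) hPp hP5 hPinj hPQR ha ha1
  rwa [← hprod] at hsil

/-! ## §3 Towers of every height over EVERY pair of `𝒮⁻` -/

/-- **Towers of every height above every bound over an arbitrary pair `(p₀, q) ∈ 𝒮⁻`.** For odd primes `p₀ ≡ 5 (mod 8)` and `q ≡ 3 (mod 4)`
and every `m`, `B` there are primes `B < p₁, …, p_m ≡ 5 (mod 8)`, pairwise distinct, with `(pᵢ/q) = (pᵢ/p₀) = +1` and `(pⱼ/pᵢ) = +1` for all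
`i ≠ j` (Dirichlet for the modulus `8·q·p₀·p₁⋯p_{m−1}`, residue `≡ 5 (mod 8)`, `≡ 1 (mod q·p₀·p₁⋯p_{m−1})`).
[cite: Tian2014, proof of Thm. 5.2 (arXiv p. 28 L44–L55)] [cite: HardyWright2008, §2.1, §8.1] -/
theorem exists_tower_primes_over {p₀ q : ℕ} (hp₀ : p₀.Prime) (hq : q.Prime) (h₀ : p₀ % 8 = 5) (hq4 : q % 4 = 3) (m B : ℕ) :
    ∃ p : Fin m → ℕ, (∀ i, (p i).Prime) ∧ (∀ i, p i % 8 = 5) ∧ (∀ i, B < p i) ∧ Function.Injective p ∧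
      (∀ i, jacobiSym (p i) q = 1) ∧ (∀ i, jacobiSym (p i) p₀ = 1) ∧ (∀ i j, i ≠ j → jacobiSym (p j) (p i) = 1) := by
  induction m with
  | zero => exact ⟨Fin.elim0, fun i => i.elim0, fun i => i.elim0, fun i => i.elim0, fun i => i.elim0, fun i => i.elim0,
      fun i => i.elim0, fun i => i.elim0⟩
  | succ m ih =>
    obtain ⟨p, hp, hp5, hpB, hinj, h3, h5, hQR⟩ := ih
    set N : ℕ := q * p₀ * ∏ i, p i with hN
    have hNodd : N % 2 = 1 := by
      have hPodd : (∏ i, p i) % 2 = 1 := by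
        rcases mod_eight_of_dvd_prod_five hp hp5 hinj (dvd_refl _) with h | h <;> omega
      have hq2 : q % 2 = 1 := by omega
      have hp2 : p₀ % 2 = 1 := by omega
      rw [hN, Nat.mul_mod, Nat.mul_mod q, hq2, hp2, hPodd]
    have hNpos : 0 < N := by
      rw [hN]; exact Nat.mul_pos (Nat.mul_pos hq.pos hp₀.pos) (Finset.prod_pos fun i _ => (hp i).pos)
    have hco : Nat.Coprime 8 N := by
      rw [show (8 : ℕ) = 2 ^ 3 by norm_num]
      exact Nat.Coprime.pow_left 3 (Nat.coprime_two_left.mpr (Nat.odd_iff.mpr hNodd))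
    obtain ⟨k, hk8, hkN⟩ := Nat.chineseRemainder hco 5 1
    have hkunit : IsUnit ((k : ZMod (8 * N))) := by
      rw [ZMod.isUnit_iff_coprime]
      refine Nat.Coprime.mul_right ?_ ?_
      · have : k % 8 = 5 := hk8
        rw [show (8 : ℕ) = 2 ^ 3 by norm_num]
        exact Nat.Coprime.pow_right 3 (Nat.coprime_two_right.mpr (Nat.odd_iff.mpr (by omega)))
      · rw [Nat.coprime_iff_gcd_eq_one, Nat.ModEq.gcd_eq hkN, Nat.gcd_one_left]
    haveI : NeZero (8 * N) := ⟨Nat.mul_ne_zero (by norm_num) hNpos.ne'⟩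
    obtain ⟨P, hPgt, hPp, hPk⟩ := Nat.forall_exists_prime_gt_and_eq_mod hkunit (B + q + p₀ + ∑ i, p i)
    have hPk' : P ≡ k [MOD 8 * N] := (ZMod.natCast_eq_natCast_iff _ _ _).mp hPk
    have hP8 : P % 8 = 5 := (hPk'.of_mul_right N).trans hk8
    have hPN : P ≡ 1 [MOD N] := (hPk'.of_mul_left 8).trans hkN
    have hPmod : ∀ d, d ∣ N → 1 < d → P % d = 1 := fun d hd hd1 => by
      have h := (hPN.of_dvd hd : P ≡ 1 [MOD d])
      rw [Nat.ModEq, Nat.mod_eq_of_lt hd1] at h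
      exact h
    have hPq : P % q = 1 := hPmod q (by rw [hN]; exact Dvd.intro (p₀ * ∏ i, p i) (by ring)) hq.one_lt
    have hPp₀ : P % p₀ = 1 := hPmod p₀ (by rw [hN]; exact Dvd.intro (q * ∏ i, p i) (by ring)) hp₀.one_lt
    have hPi : ∀ i, P % p i = 1 := fun i =>
      hPmod (p i) (by rw [hN]; exact (Finset.dvd_prod_of_mem p (mem_univ i)).trans (dvd_mul_left _ (q * p₀))) (hp i).one_lt
    have hPgt' : ∀ i, p i < P := fun i =>
      lt_of_le_of_lt (Finset.single_le_sum (fun j _ => Nat.zero_le (p j)) (mem_univ i)) (by omega)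
    refine ⟨vecCons P p, ?_, ?_, ?_, ?_, ?_, ?_, ?_⟩
    · exact fun i => Fin.cases (by simpa using hPp) (fun j => by simpa using hp j) i
    · exact fun i => Fin.cases (by simpa using hP8) (fun j => by simpa using hp5 j) i
    · exact fun i => Fin.cases (by simp; omega) (fun j => by simpa using hpB j) i
    · have h : Function.Injective (Fin.cons P p : Fin (m + 1) → ℕ) := by
        rw [Fin.cons_injective_iff]
        exact ⟨by rintro ⟨i, hi⟩; exact (hPgt' i).ne hi, hinj⟩
      exact h
    · exact fun i => Fin.cases (by simpa using jacobiSym_eq_one_of_mod_eq_one hPq) (fun j => by simpa using h3 j) i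
    · exact fun i => Fin.cases (by simpa using jacobiSym_eq_one_of_mod_eq_one hPp₀) (fun j => by simpa using h5 j) i
    · intro i j hij
      induction i using Fin.cases with
      | zero =>
        induction j using Fin.cases with
        | zero => exact absurd rfl hij
        | succ j' =>
          simp only [cons_val_zero, cons_val_succ]
          rw [jacobiSym.quadratic_reciprocity_one_mod_four (by have := hp5 j'; omega) (hPp.odd_of_ne_two (by omega))]
          exact jacobiSym_eq_one_of_mod_eq_one (hPi j')
      | succ i' =>
        induction j using Fin.cases with
        | zero =>
          simp only [cons_val_zero, cons_val_succ]
          exact jacobiSym_eq_one_of_mod_eq_one (hPi i')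
        | succ j' =>
          simp only [cons_val_succ]
          exact hQR i' j' fun h => hij (by rw [h])

/-- **Every pair of `𝒮⁻` carries towers of every height above every bound with (a)+(b).** For `(p₀, q) ∈ 𝒮⁻` (`p₀ ≡ 5 (mod 8)`, `q ≡ 3 (mod 4)`,
`(p₀/q) = −1`) and every `m`, `B`: an injective `p : Fin m → primes ≡ 5 (mod 8)` above `B` with, for `n = 2·q·p₀·p₁⋯p_m`, `ord_{s=1} L(E_n, s) = 1`,
rank `E_n(ℚ) = 1`, `Ш(E_n)[2^∞] = 0` and `BSD(E_n, 2)`. Relative to {`tyz_cmPointGaloisData`, `thm11_parity_of_scriptL`, GZK,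
`monsky_card_selmerGroup_two_even`}; nothing asserted; no class booked; NOT refereed.
[cite: Tian2014, Thm. 1.1, Thm. 5.2] [cite: Monsky1990MockHeegner, p. 67 Remark (3)] [cite: TianYuanZhang2017, §1 (1.1), Thm. 3.5] -/
theorem forall_exists_sminus_tower_over (hCM : tyz_cmPointGaloisData) (hGZK : rank_eq_analyticRank_of_analyticRank_le_one)
    (hMe : monsky_card_selmerGroup_two_even) (h11 : thm11_parity_of_scriptL) {p₀ q : ℕ} (hp₀ : p₀.Prime) (hq : q.Prime)
    (h₀ : p₀ % 8 = 5) (hq4 : q % 4 = 3) (hmark : jacobiSym p₀ q = -1) (m B : ℕ) :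
    ∃ p : Fin m → ℕ, (∀ i, (p i).Prime ∧ p i % 8 = 5 ∧ B < p i) ∧ Function.Injective p ∧
      (congruentNumberCurve (2 * (q * (p₀ * ∏ i, p i)))).analyticRank = 1 ∧
      (congruentNumberCurve (2 * (q * (p₀ * ∏ i, p i)))).mordellWeilRank = 1 ∧
      AddCommGroup.primaryComponent (congruentNumberCurve (2 * (q * (p₀ * ∏ i, p i)))).sha 2 = ⊥ ∧
      BSDp (congruentNumberCurve (2 * (q * (p₀ * ∏ i, p i)))) 2 := by
  obtain ⟨p, hp, hp5, hpB, hinj, hq1, hres, hQR⟩ := exists_tower_primes_over hp₀ hq h₀ hq4 m B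
  exact ⟨p, fun i => ⟨hp i, hp5 i, hpB i⟩, hinj,
    rankOne_sha_bsdp_two_sminus_tower hCM hGZK hMe h11 m p₀ q p hp₀ hq h₀ hq4 hmark hp hp5 hinj hq1 hres hQR⟩

end ThetaDescent

end Summit.BirchSwinnertonDyer.Rank1Residual.P2

end
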